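import Summits.ValiantsHypothesis.ValiantsHypothesis.Theorems.LacunarySymmetroidMatrixDescartesCensusDefs
import Summits.ValiantsHypothesis.ValiantsHypothesis.Theorems.LacunarySymmetroidMatrixDescartesStubDescartesCeiling
import Summits.ValiantsHypothesis.ValiantsHypothesis.Theorems.SymmetroidPencilBasics
import Literature.Computability.AlgebraicComplexity.RealTauKnownCases

/-!
# `MatrixDescartes` census — the ENVELOPE BUDGET: along the roots of a hypothetical twenty the trace flips at most 3 times

HONEST FRAMING.  Object-search cell `pub-symmetroid`, door-A seat `val-sym-door-p1` (items stmt-ValiantsHypothesis-19979 `DoorA26`,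
19980 `DoorA34`; OPEN, never asserted).  A located NECESSARY CONDITION on a hypothetical twenty, valid on EVERY support, of a new
(root-side, «envelope») kind.  Let `F = ∑ X^(d l) • S l` be a real symmetric `2 × 2` six-term pencil whose determinant has `20` distinct
positive roots `r₁ < ⋯ < r₂₀`.  By `…CensusTwentyRootStructure` every `F(r_k)` is semidefinite of rank one with a TYPE
`sign tr F(r_k) ≠ 0`.  TARGET (not yet in the kernel; this file is its TOOLKIT): «the type changes at most `3` times along `k = 1, …, 20`»
(the trivial bound is `5`: `tr F` is a six-nomial).  Mechanism (the envelope budget): for every direction `u ≠ 0` the quadratic form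
`f_u(x) = uᵀ F(x) u` is a six-nomial (`≤ 5` positive roots), it is `> 0` wherever `F(x) ≻ 0` and `< 0` wherever `F(x) ≺ 0`; the
`20` simple roots cut `(0, ∞)` into alternately DEFINITE and INDEFINITE gaps, a type flip can only happen across an indefinite gap and
costs EVERY `f_u` one sign change, while an indefinite gap WITHOUT flip costs a suitable `f_u` two sign changes (a dip); since at most `5`
of the `≥ 9` inner indefinite gaps can flip, a flip-free one exists, and `#flips + 2 ≤ 5`.

Contents (the toolkit, all elementary, all supports): `pencil_eval_apply`, `quadForm_pencil_eval` (the form `uᵀF(x)u` is the `K`-nomial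
`∑ x^(d l) uᵀS_l u`), `eval_det_pencil_one` / `card_posRoots_nomial_lt` (a `K`-nomial is the determinant of a `1 × 1` lacunary pencil, so
the tree's support-level Descartes bound gives `< K` positive roots), `exists_quadForm_neg_of_det_neg` / `exists_quadForm_pos_of_det_neg`
(an indefinite symmetric `2 × 2` matrix has directions of both signs — the DIP directions), `trace_mul_quadForm_pos_of_det_pos` (on a
definite matrix every direction has the sign of the trace — the TYPE).  The budget count itself (midpoint bookkeeping between the 20 roots,
`…SignChangeCount.card_le_card_posRoots_of_signChanges`) is left to the successor seat; plan in the seat's NOTES/REPORT.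
Nothing here bounds `ζ_sym(2,6)`, decides `DoorA26`/`DoorA34`, or bears on `MatrixDescartes` (stmt-ValiantsHypothesis-18050) / `VP ≠ VNP`.

[folklore] Envelope/budget argument of the seat's report DOOR-A-P1-REPORT §3; intermediate value theorem + sparse Descartes.
-/

-- `Summit.ValiantsHypothesis.ValiantsHypothesis.…` repeats a component by the D-0017 layout
-- (single-conjunct summit), which the `dupNamespace` linter flags; the name is mandated.
set_option linter.dupNamespace false

namespace Summit.ValiantsHypothesis.ValiantsHypothesis.Theorems.LacunarySymmetroidMatrixDescartes.Census

open Polynomial Finset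
open scoped BigOperators Polynomial Matrix
open Summit.ValiantsHypothesis.ValiantsHypothesis.Theorems.MatrixDescartes.Negative (PosRootLawAt)
open Summit.ValiantsHypothesis.ValiantsHypothesis.Theorems.SymmetroidDescartes (eval_det_pencil)

/-! ### One-by-one pencils: the quadratic form in a fixed direction and the trace are six-nomials -/

/-- Entries of the evaluated pencil. [folklore] -/
theorem pencil_eval_apply {K m : ℕ} (d : Fin K → ℕ) (S : Fin K → Matrix (Fin m) (Fin m) ℝ) (x : ℝ) (i j : Fin m) :
    (∑ l, x ^ d l • S l) i j = ∑ l, x ^ d l * S l i j := by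
  rw [Matrix.sum_apply]
  exact Finset.sum_congr rfl fun l _ => by rw [Matrix.smul_apply, smul_eq_mul]

/-- The quadratic form of the evaluated pencil in direction `u` is the `K`-nomial `∑ x^(d l) · uᵀ S_l u`. [folklore] -/
theorem quadForm_pencil_eval {K : ℕ} (d : Fin K → ℕ) (S : Fin K → Matrix (Fin 2) (Fin 2) ℝ) (u : Fin 2 → ℝ) (x : ℝ) :
    u ⬝ᵥ ((∑ l, x ^ d l • S l) *ᵥ u) = ∑ l, x ^ d l * (u ⬝ᵥ (S l *ᵥ u)) := by
  rw [Matrix.sum_mulVec, dotProduct_sum]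
  exact Finset.sum_congr rfl fun l _ => by rw [Matrix.smul_mulVec, dotProduct_smul, smul_eq_mul]

/-- A `K`-nomial `x ↦ ∑ x^(d l) c_l` is the determinant of the `1 × 1` lacunary pencil with letters `c_l`, evaluated at `x`. [folklore] -/
theorem eval_det_pencil_one {K : ℕ} (d : Fin K → ℕ) (c : Fin K → ℝ) (x : ℝ) :
    (Matrix.det (∑ l, ((X : ℝ[X]) ^ d l) • (!![c l] : Matrix (Fin 1) (Fin 1) ℝ).map C)).eval x = ∑ l, x ^ d l * c l := by
  rw [eval_det_pencil (fun l => (!![c l] : Matrix (Fin 1) (Fin 1) ℝ)) d x, Matrix.det_fin_one, pencil_eval_apply]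
  rfl

/-- **Sparse Descartes for a `K`-nomial in pencil clothing**: if `x ↦ ∑ x^(d l) c_l` takes a non-zero value somewhere, it has fewer than
`K` distinct positive roots — stated through the `1 × 1` pencil so that the tree's support count applies (`K ≥ 1`). [folklore] -/
theorem card_posRoots_nomial_lt {K : ℕ} (d : Fin K → ℕ) (c : Fin K → ℝ)
    (hne : Matrix.det (∑ l, ((X : ℝ[X]) ^ d l) • (!![c l] : Matrix (Fin 1) (Fin 1) ℝ).map C) ≠ 0) :
    ((Matrix.det (∑ l, ((X : ℝ[X]) ^ d l) • (!![c l] : Matrix (Fin 1) (Fin 1) ℝ).map C)).roots.toFinset.filter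
      (fun t => 0 < t)).card < K := by
  have h1 := Literature.Computability.AlgebraicComplexity.card_roots_toFinset_filter_pos_lt_card_support hne
  have h2 := StubDescartesCeiling.card_support_det_pencil_le d (fun l => (!![c l] : Matrix (Fin 1) (Fin 1) ℝ))
  have h3 : Nat.choose (1 + K - 1) 1 = K := by
    rw [show 1 + K - 1 = K by omega, Nat.choose_one_right]
  rw [h3] at h2
  exact lt_of_lt_of_le h1 h2

/-! ### Indefinite and definite symmetric `2 × 2` matrices -/

/-- An indefinite (`det < 0`) real symmetric `2 × 2` matrix has a strictly NEGATIVE direction. [folklore] -/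
theorem exists_quadForm_neg_of_det_neg (M : Matrix (Fin 2) (Fin 2) ℝ) (hM : M.IsSymm) (hdet : M.det < 0) :
    ∃ u : Fin 2 → ℝ, u ⬝ᵥ (M *ᵥ u) < 0 := by
  have hs : M 1 0 = M 0 1 := by
    have h := congrFun (congrFun hM 0) 1
    simpa [Matrix.transpose_apply] using h
  rw [Matrix.det_fin_two, hs] at hdet
  have hq : ∀ u : Fin 2 → ℝ, u ⬝ᵥ (M *ᵥ u) = M 0 0 * u 0 ^ 2 + 2 * M 0 1 * u 0 * u 1 + M 1 1 * u 1 ^ 2 := by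
    intro u
    simp only [Matrix.mulVec, dotProduct, Fin.sum_univ_two, hs]
    ring
  by_cases h0 : M 0 0 < 0
  · refine ⟨![1, 0], ?_⟩
    rw [hq]; simp; linarith
  by_cases h1 : M 1 1 < 0
  · refine ⟨![0, 1], ?_⟩
    rw [hq]; simp; linarith
  rw [not_lt] at h0 h1
  by_cases h00 : M 0 0 = 0
  · -- then `M₀₁ ≠ 0`; take `u = (M₁₁ + 1, −2 M₀₁)`
    have hb : M 0 1 ≠ 0 := by
      intro hb; rw [h00, hb] at hdet; simp at hdet
    refine ⟨![M 1 1 + 1, -2 * M 0 1], ?_⟩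
    rw [hq]; simp [h00]
    nlinarith [sq_nonneg (M 0 1), mul_pos (show (0:ℝ) < 4 by norm_num) (lt_of_le_of_ne (sq_nonneg (M 0 1)) (Ne.symm (pow_ne_zero 2 hb)))]
  · -- `M₀₀ > 0`; take `u = (M₀₁, −M₀₀)`: the form equals `M₀₀ · det M < 0`
    have h0' : 0 < M 0 0 := lt_of_le_of_ne h0 (Ne.symm h00)
    refine ⟨![M 0 1, -M 0 0], ?_⟩
    rw [hq]; simp
    nlinarith [mul_neg_of_pos_of_neg h0' hdet]

/-- An indefinite real symmetric `2 × 2` matrix has a strictly POSITIVE direction. [folklore] -/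
theorem exists_quadForm_pos_of_det_neg (M : Matrix (Fin 2) (Fin 2) ℝ) (hM : M.IsSymm) (hdet : M.det < 0) :
    ∃ u : Fin 2 → ℝ, 0 < u ⬝ᵥ (M *ᵥ u) := by
  have hM' : (-M).IsSymm := by
    unfold Matrix.IsSymm at hM ⊢; rw [Matrix.transpose_neg, hM]
  have hdet' : (-M).det < 0 := by
    rw [Matrix.det_neg, Fintype.card_fin]; norm_num; exact hdet
  obtain ⟨u, hu⟩ := exists_quadForm_neg_of_det_neg (-M) hM' hdet'
  refine ⟨u, ?_⟩
  rw [Matrix.neg_mulVec, dotProduct_neg] at hu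
  linarith

/-- On a DEFINITE symmetric `2 × 2` matrix (`det > 0`) every non-zero direction has the strict sign of the trace:
`tr M · uᵀ M u > 0`. [folklore] -/
theorem trace_mul_quadForm_pos_of_det_pos (M : Matrix (Fin 2) (Fin 2) ℝ) (hM : M.IsSymm) (hdet : 0 < M.det)
    (u : Fin 2 → ℝ) (hu : u ≠ 0) : 0 < (M 0 0 + M 1 1) * (u ⬝ᵥ (M *ᵥ u)) := by
  have hs : M 1 0 = M 0 1 := by
    have h := congrFun (congrFun hM 0) 1
    simpa [Matrix.transpose_apply] using h
  rw [Matrix.det_fin_two, hs] at hdet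
  have hq : u ⬝ᵥ (M *ᵥ u) = M 0 0 * u 0 ^ 2 + 2 * M 0 1 * u 0 * u 1 + M 1 1 * u 1 ^ 2 := by
    simp only [Matrix.mulVec, dotProduct, Fin.sum_univ_two, hs]
    ring
  rw [hq]
  -- `(a + c)(a u₀² + 2 b u₀ u₁ + c u₁²) = (a u₀ + b u₁)² + (b u₀ + c u₁)² + (ac − b²)(u₀² + u₁²)`
  have key : (M 0 0 + M 1 1) * (M 0 0 * u 0 ^ 2 + 2 * M 0 1 * u 0 * u 1 + M 1 1 * u 1 ^ 2)
      = (M 0 0 * u 0 + M 0 1 * u 1) ^ 2 + (M 0 1 * u 0 + M 1 1 * u 1) ^ 2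
        + (M 0 0 * M 1 1 - M 0 1 * M 0 1) * (u 0 ^ 2 + u 1 ^ 2) := by ring
  rw [key]
  have hu2 : 0 < u 0 ^ 2 + u 1 ^ 2 := by
    by_contra hle
    rw [not_lt] at hle
    have h0 : u 0 = 0 := by nlinarith [sq_nonneg (u 0), sq_nonneg (u 1)]
    have h1 : u 1 = 0 := by nlinarith [sq_nonneg (u 0), sq_nonneg (u 1)]
    apply hu; funext i; fin_cases i
    · exact h0
    · exact h1
  have := mul_pos hdet hu2
  nlinarith [sq_nonneg (M 0 0 * u 0 + M 0 1 * u 1), sq_nonneg (M 0 1 * u 0 + M 1 1 * u 1)]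

end Summit.ValiantsHypothesis.ValiantsHypothesis.Theorems.LacunarySymmetroidMatrixDescartes.Census
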